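import Summits.Ventures.HSemireg.WedgeHankelSwap
import Summits.Ventures.HSemireg.WedgeHankelConfluentRank

/-!
# Venture HSemireg — THE SCALING `y_a ↦ μ y_a` (`Θ ↦ μΘ`): the third generator of the `GL₂`-action on the frame pair; it multiplies the node by `μ`,
# fixes the Siegel ideal and every Dolbeault block, and carries `w_m(q)` to `w_m((μ^j q_j)_j)`

HONEST FRAMING. Part of the Lean index of the computation cell `pub-hsemireg` (seat p10 gen 15, Sunday typer «UNIFORM-IN-n»).
Finite-dimensional EXTERIOR ALGEBRA over a field ONLY: no variety, no cohomology theory, no sheaf, no Ext group, no semiregularity map;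
nothing here says that HC / HC_CM / HC_AV holds; no Literature fact is declared or used.  Custodian versions as in `WedgeHankelSiegelIdeal` (1/3) and
`WedgeHankelFrameChange`; the dictionary (`v(Θ) ↦ v(μΘ)` ↦ `q_j ↦ μ^j q_j`; the node `λ ↦ μλ`) is QUOTED, never asserted.

THIS FILE (continues namespace `Summit.Ventures.HSemireg.Wedge.HankelFrameChange`; imports E7 and E6): for a unit `μ` (`μ ≠ 0`)
* §41 the scaling `e_{y_a} ↦ μ e_{y_a}` of the generators (linear equivalence, inverse `μ⁻¹`) and **`Δs μ := mapEquiv (scale μ)`**: `Δs μ (x_a) = x_a`,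
  `Δs μ (y_a) = μ y_a`; **`Δs_w`: `Δs μ (w_m(q)) = w_m(scaleSeq μ q)`**, `(scaleSeq μ q)_j = μ^j q_j`.
* §42 TRANSPORT (E7's `Kr_mapEquiv`): `Kr_w_scaleSeq`; the Siegel vectors are scaled (`Δs_sv`: `Δs μ (s_{ab}) = μ s_{ab}`), so **`map_Δs_siegelIdeal`: `Δs μ (SI_k) = SI_k`**;
  **`map_Δs_plane`: every block `plane(a,b)` is invariant**, hence `xRich`, `yRich`; `Δs μ (x_a + λ y_a) = x_a + λμ y_a` (`Δs_uvec`: the node `λ ↦ λμ`).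
* §43 so the node-`0` / node-`∞` kernel laws are scale-INVARIANT as subspaces (`Kr_w_scaleSeq_of_order`), and with E5's `Φs` and E7's `Ψs` the lineage
  holds the three generators (shear, inversion, scaling) of the `GL₂`-action on the pair `(x_a, y_a)` — the Möbius group acting on the nodes.
* §44 with THEOREM H (E6's kernel count): **`rank_hankel1_rev`: `rank H_k(rev_n q) = rank H_k(q)`** and **`rank_hankel1_scaleSeq`: `rank H_k((μ^j q_j)) = rank H_k(q)`**
  (`μ ≠ 0`) for every `q`, `k` — with E6's `rank_hankel1_expMul` all three generators preserve every catalecticant rank.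
NOT typed here: the composite action of a general `g ∈ GL₂` on `w_m(q)` (binary-form transformation of the coefficients); anything Ext-side.  Class side only.
-/

open Module

namespace Summit.Ventures.HSemireg.Wedge.HankelFrameChange

open Summit.Ventures.HSemireg.Wedge Summit.Ventures.HSemireg.Wedge.Kunneth Summit.Ventures.HSemireg.Wedge.Hankel
  Summit.Ventures.HSemireg.Wedge.BasisFree Summit.Ventures.HSemireg.Wedge.HankelSiegel Summit.Ventures.HSemireg.Wedge.HankelSiegelIdeal
  Summit.Ventures.HSemireg.Wedge.KunnethKernel

variable (K : Type*) [Field K] {n : ℕ}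

/-! ## §41. The scaling of the `y`-generators and the induced automorphism -/

/-- the scaling on coefficient vectors: `(scaleLin μ v)(y_a) = μ·v(y_a)`, `(scaleLin μ v)(x_a) = v(x_a)`. -/
noncomputable def scaleLin (mu : K) : (In n → K) →ₗ[K] (In n → K) where
  toFun v i := if n ≤ (i : ℕ) then mu * v i else v i
  map_add' v v' := by funext i; simp only [Pi.add_apply]; split_ifs <;> ring
  map_smul' c v := by funext i; simp only [Pi.smul_apply, smul_eq_mul, RingHom.id_apply]; split_ifs <;> ring

/-- the scaling, pointwise. -/
lemma scaleLin_apply (mu : K) (v : In n → K) (i : In n) : scaleLin K mu v i = if n ≤ (i : ℕ) then mu * v i else v i := rfl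

/-- `scale μ⁻¹` undoes `scale μ` (`μ ≠ 0`). -/
lemma scaleLin_inv_comp {mu : K} (hmu : mu ≠ 0) (v : In n → K) : scaleLin K mu⁻¹ (scaleLin K mu v) = v := by
  funext i; rw [scaleLin_apply, scaleLin_apply]
  split_ifs with h
  · rw [← mul_assoc, inv_mul_cancel₀ hmu, one_mul]
  · rfl

/-- **the scaling as a linear equivalence** (`μ ≠ 0`). -/
noncomputable def scale {mu : K} (hmu : mu ≠ 0) : (In n → K) ≃ₗ[K] (In n → K) where
  toLinearMap := scaleLin K mu
  invFun := scaleLin K mu⁻¹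
  left_inv v := scaleLin_inv_comp K hmu v
  right_inv v := by
    have := scaleLin_inv_comp K (inv_ne_zero hmu) v
    rwa [inv_inv] at this

/-- the scaling fixes `e_{x_a}`. -/
lemma scale_b_castAdd {mu : K} (hmu : mu ≠ 0) (a : Fin n) : scale K (n := n) hmu (b K (In n) (Fin.castAdd n a)) = b K (In n) (Fin.castAdd n a) := by
  funext i
  show scaleLin K mu _ i = _
  rw [scaleLin_apply, b_apply']
  by_cases h : n ≤ (i : ℕ)
  · rw [if_pos h, if_neg (ne_castAdd_of_le h a), mul_zero]
  · rw [if_neg h]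

/-- the scaling multiplies `e_{y_a}` by `μ`. -/
lemma scale_b_natAdd {mu : K} (hmu : mu ≠ 0) (a : Fin n) :
    scale K (n := n) hmu (b K (In n) (Fin.natAdd n a)) = mu • b K (In n) (Fin.natAdd n a) := by
  funext i
  show scaleLin K mu _ i = _
  rw [scaleLin_apply, Pi.smul_apply, smul_eq_mul, b_apply']
  by_cases h : n ≤ (i : ℕ)
  · rw [if_pos h]
  · rw [if_neg h, if_neg (ne_natAdd_of_lt h a), mul_zero]

/-- **THE SCALING AUTOMORPHISM `Δs μ := mapEquiv (scale μ)`** of `⋀(K^{2n})`. -/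
noncomputable def Δs {mu : K} (hmu : mu ≠ 0) : HT K (In n) ≃ₐ[K] HT K (In n) := mapEquiv K (scale K (n := n) hmu)

/-- `Δs μ (ι v) = ι (scale μ v)`. -/
lemma Δs_ι {mu : K} (hmu : mu ≠ 0) (v : In n → K) : Δs K hmu (ExteriorAlgebra.ι K v) = ExteriorAlgebra.ι K (scale K hmu v) := by
  rw [Δs, mapEquiv_apply, ExteriorAlgebra.map_apply_ι]; rfl

/-- **`Δs μ (x_a) = x_a`.** -/
theorem Δs_X {mu : K} (hmu : mu ≠ 0) (a : Fin n) : Δs K (n := n) hmu (X K n a) = X K n a := by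
  rw [X_fin, Δs_ι, scale_b_castAdd]

/-- **`Δs μ (y_a) = μ y_a`.** -/
theorem Δs_Y {mu : K} (hmu : mu ≠ 0) (a : Fin n) : Δs K (n := n) hmu (Y K n a) = mu • Y K n a := by
  rw [Y_fin, Δs_ι, scale_b_natAdd, map_smul]

/-- `ℕ`-indexed forms. -/
lemma Δs_X' {mu : K} (hmu : mu ≠ 0) (c : ℕ) : Δs K (n := n) hmu (X K n c) = X K n c := by
  by_cases hc : c < n
  · exact Δs_X K hmu ⟨c, hc⟩
  · rw [X, dif_neg hc, map_zero]

/-- `ℕ`-indexed forms. -/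
lemma Δs_Y' {mu : K} (hmu : mu ≠ 0) (c : ℕ) : Δs K (n := n) hmu (Y K n c) = mu • Y K n c := by
  by_cases hc : c < n
  · exact Δs_Y K hmu ⟨c, hc⟩
  · rw [Y, dif_neg hc, map_zero, smul_zero]

/-- the scaled coefficient sequence `(scaleSeq μ q)_j = μ^j q_j` (dictionary: `v(Θ) ↦ v(μΘ)`). -/
def scaleSeq (mu : K) (q : ℕ → K) : ℕ → K := fun j => mu ^ j * q j

/-- `σ(scaleSeq μ q) = μ · scaleSeq μ (σ q)`. -/
lemma shift_scaleSeq (mu : K) (q : ℕ → K) : shift K (scaleSeq K mu q) = fun j => mu * scaleSeq K mu (shift K q) j := by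
  funext j; simp only [shift_apply, scaleSeq, pow_succ]; ring

/-- **`Δs μ (w_m(q)) = w_m(scaleSeq μ q)`** for every `m ≤ n` and `q` (th-7's recursion: the `y_m`-branch picks up one factor `μ`). -/
theorem Δs_w {mu : K} (hmu : mu ≠ 0) {m : ℕ} (hm : m ≤ n) (q : ℕ → K) : Δs K (n := n) hmu (w K n m q) = w K n m (scaleSeq K mu q) := by
  induction m generalizing q with
  | zero => rw [w, w, map_smul, map_one]; simp [scaleSeq]
  | succ m ih =>
    have hmn : m < n := by omega
    have hX : X K n m = X K n (⟨m, hmn⟩ : Fin n) := rfl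
    have hY : Y K n m = Y K n (⟨m, hmn⟩ : Fin n) := rfl
    rw [w, w, map_add, map_mul, map_mul, ih (by omega), ih (by omega), hX, hY, Δs_X, Δs_Y, shift_scaleSeq, w_smul, mul_smul_comm,
      smul_mul_assoc]

/-! ## §42. Transport: kernels, the Siegel ideal, the blocks -/

/-- **`Kr(univ, w_n(scaleSeq μ q), k) = Δs μ (Kr(univ, w_n(q), k))`.** -/
theorem Kr_w_scaleSeq {mu : K} (hmu : mu ≠ 0) (q : ℕ → K) (k : ℕ) :
    Kr K Finset.univ (w K n n (scaleSeq K mu q)) k = (Kr K Finset.univ (w K n n q) k).map (Δs K (n := n) hmu).toLinearMap := by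
  rw [← Δs_w K hmu le_rfl]; exact Kr_mapEquiv K _ _ k

/-- **the Siegel vectors are scaled: `Δs μ (s_{ab}) = μ s_{ab}`.** -/
theorem Δs_sv {mu : K} (hmu : mu ≠ 0) (a c : ℕ) : Δs K (n := n) hmu (sv K (n := n) a c) = mu • sv K a c := by
  rw [sv]
  by_cases hac : a = c
  · subst hac; rw [if_pos rfl, add_zero, map_mul, Δs_X', Δs_Y', mul_smul_comm]
  · rw [if_neg hac, map_add, map_mul, map_mul, Δs_X', Δs_Y', Δs_X', Δs_Y', mul_smul_comm, mul_smul_comm, smul_add]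

/-- **THE SIEGEL IDEAL IS SCALE-INVARIANT: `Δs μ (SI_k) = SI_k`.** -/
theorem map_Δs_siegelIdeal {mu : K} (hmu : mu ≠ 0) (k : ℕ) :
    (siegelIdeal K n k).map (Δs K (n := n) hmu).toLinearMap = siegelIdeal K n k := by
  have hle : (siegelIdeal K n k).map (Δs K (n := n) hmu).toLinearMap ≤ siegelIdeal K n k := by
    rw [siegelIdeal, Submodule.map_span, Submodule.span_le]
    rintro _ ⟨_, ⟨p, rfl⟩, rfl⟩
    obtain ⟨⟨t, ht⟩, s⟩ := p
    subst ht
    rw [SetLike.mem_coe, AlgEquiv.toLinearMap_apply, igen, map_mul, sgen, Δs_sv, ← sgen, mul_smul_comm]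
    have hB : B K (In n) t ∈ ⋀[K]^t.card (In n → K) := by
      rw [exteriorPower_eq_Hom_univ]; exact B_mem_Hom K (Finset.subset_univ t) rfl
    exact Submodule.smul_mem _ _ (mul_sgen_mem_siegelIdeal K (mapEquiv_mem_exteriorPower K _ hB) s)
  exact Submodule.eq_of_le_of_finrank_eq hle ((Δs K (n := n) hmu).toLinearEquiv.finrank_map_eq _)

/-- `Δs μ (x_P) = x_P`. -/
lemma Δs_B_xs {mu : K} (hmu : mu ≠ 0) (P : Finset (Fin n)) : Δs K (n := n) hmu (B K (In n) (xs P)) = B K (In n) (xs P) := by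
  induction P using Finset.induction_on with
  | empty => rw [xs, Finset.map_empty, B_empty, map_one]
  | insert a P ha ih =>
    obtain ⟨c, hc, h⟩ := B_mul_gx K (I := In n) (i := Fin.castAdd n a) (t := xs P) (by rw [castAdd_mem_xs]; exact ha)
    have e : B K (In n) (xs (insert a P)) = c⁻¹ • (B K (In n) (xs P) * gx K (Fin.castAdd n a)) := by
      rw [xs_insert, h, smul_smul, inv_mul_cancel₀ hc, one_smul]
    rw [e, map_smul, map_mul, ← X_eq_gx, Δs_X, ih]

/-- `Δs μ (y_Q) = μ^{|Q|} y_Q`. -/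
lemma Δs_B_ys {mu : K} (hmu : mu ≠ 0) (Q : Finset (Fin n)) : Δs K (n := n) hmu (B K (In n) (ys Q)) = mu ^ Q.card • B K (In n) (ys Q) := by
  induction Q using Finset.induction_on with
  | empty => rw [ys, Finset.map_empty, B_empty, map_one, Finset.card_empty, pow_zero, one_smul]
  | insert a Q ha ih =>
    obtain ⟨c, hc, h⟩ := B_mul_gx K (I := In n) (i := Fin.natAdd n a) (t := ys Q) (by rw [natAdd_mem_ys]; exact ha)
    have e : B K (In n) (ys (insert a Q)) = c⁻¹ • (B K (In n) (ys Q) * gx K (Fin.natAdd n a)) := by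
      rw [ys_insert, h, smul_smul, inv_mul_cancel₀ hc, one_smul]
    rw [e, map_smul, map_mul, ← Y_eq_gx, Δs_Y, ih, Finset.card_insert_of_notMem ha]
    simp only [smul_mul_assoc, mul_smul_comm, smul_smul]
    congr 1; ring

/-- `Δs μ` of a plane monomial is a non-zero multiple of it. -/
lemma Δs_pmon {mu : K} (hmu : mu ≠ 0) {a b : ℕ} (i : PIdx n a b) : Δs K (n := n) hmu (pmon K i) = mu ^ b • pmon K i := by
  obtain ⟨c, -, h⟩ := pmon_eq_smul_mul K i
  rw [h, map_smul, map_mul, Δs_B_xs, Δs_B_ys, i.2.2, mul_smul_comm, smul_comm]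

/-- **EVERY DOLBEAULT BLOCK IS SCALE-INVARIANT: `Δs μ (plane(a,b)) = plane(a,b)`.** -/
theorem map_Δs_plane {mu : K} (hmu : mu ≠ 0) (a b : ℕ) : (plane K n a b).map (Δs K (n := n) hmu).toLinearMap = plane K n a b := by
  have hle : (plane K n a b).map (Δs K (n := n) hmu).toLinearMap ≤ plane K n a b := by
    rw [plane, Submodule.map_span, Submodule.span_le]
    rintro _ ⟨_, ⟨i, rfl⟩, rfl⟩
    rw [SetLike.mem_coe, AlgEquiv.toLinearMap_apply, Δs_pmon]
    exact Submodule.smul_mem _ _ (Submodule.subset_span ⟨i, rfl⟩)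
  exact Submodule.eq_of_le_of_finrank_eq hle ((Δs K (n := n) hmu).toLinearEquiv.finrank_map_eq _)

/-- hence `xRich`, `yRich` are scale-invariant. -/
theorem map_Δs_xRich {mu : K} (hmu : mu ≠ 0) (k P : ℕ) : (xRich K n k P).map (Δs K (n := n) hmu).toLinearMap = xRich K n k P := by
  rw [xRich, Submodule.map_iSup]
  refine iSup_congr fun a => ?_
  rw [Submodule.map_iSup]
  exact iSup_congr fun _ => map_Δs_plane K hmu _ _

/-- the scaling moves the frame of the node `λ` to that of the node `λμ`: `Δs μ (x_a + λ y_a) = x_a + (λμ) y_a`. -/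
theorem Δs_uvec {mu : K} (hmu : mu ≠ 0) (lam : K) (a : Fin n) : Δs K (n := n) hmu (X K n a + lam • Y K n a) = X K n a + (lam * mu) • Y K n a := by
  rw [map_add, map_smul, Δs_X, Δs_Y, smul_smul]

/-! ## §43. Scale-invariance of the node-`0` kernel law -/

/-- **the kernel of a class of order `P` at `0` is scale-invariant**: `Δs μ (Kr(univ, w_n(q), k)) = Kr(univ, w_n(q), k) = Kr(univ, w_n(scaleSeq μ q), k)`
for `q` supported on `[0,P]`, `q_P ≠ 0`, `k + P ≤ n`. -/
theorem Kr_w_scaleSeq_of_order {mu : K} (hmu : mu ≠ 0) {k P : ℕ} (hkP : k + P ≤ n) {q : ℕ → K} (hq : ∀ j, P < j → q j = 0) (hqP : q P ≠ 0) :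
    Kr K Finset.univ (w K n n (scaleSeq K mu q)) k = Kr K Finset.univ (w K n n q) k := by
  rw [Kr_w_scaleSeq K hmu, Kr_w_eq_of_order K hkP hq hqP, Submodule.map_sup, map_Δs_siegelIdeal, map_Δs_xRich]

/-! ## §44. Hankel ranks are invariant under reversal and scaling -/

/-- **REVERSAL PRESERVES EVERY HANKEL RANK: `rank H_k(rev_n q) = rank H_k(q)`** (E7's swap transports the kernel; THEOREM H on both sides; classically
`H_k(rev q)` is `H_k(q)` with rows and columns reversed). -/
theorem rank_hankel1_rev (k : ℕ) (q : ℕ → K) : (hankel1 K n k (rev K n q)).rank = (hankel1 K n k q).rank := by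
  by_cases hk : k ≤ n
  · have h1 := finrank_Kr_w_add_rank K (n := n) k q
    have h2 := finrank_Kr_w_add_rank K (n := n) k (rev K n q)
    rw [Kr_w_rev, (Ψs K (n := n)).toLinearEquiv.finrank_map_eq] at h2
    exact Nat.eq_of_mul_eq_mul_left (Nat.choose_pos hk) (by omega)
  · rw [rank_hankel1_eq_zero_of_lt K (by omega), rank_hankel1_eq_zero_of_lt K (by omega)]

/-- **SCALING PRESERVES EVERY HANKEL RANK: `rank H_k((μ^j q_j)_j) = rank H_k(q)`** for `μ ≠ 0` (classically a diagonal conjugation of the catalecticant). -/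
theorem rank_hankel1_scaleSeq {mu : K} (hmu : mu ≠ 0) (k : ℕ) (q : ℕ → K) :
    (hankel1 K n k (scaleSeq K mu q)).rank = (hankel1 K n k q).rank := by
  by_cases hk : k ≤ n
  · have h1 := finrank_Kr_w_add_rank K (n := n) k q
    have h2 := finrank_Kr_w_add_rank K (n := n) k (scaleSeq K mu q)
    rw [Kr_w_scaleSeq K hmu, (Δs K (n := n) hmu).toLinearEquiv.finrank_map_eq] at h2
    exact Nat.eq_of_mul_eq_mul_left (Nat.choose_pos hk) (by omega)
  · rw [rank_hankel1_eq_zero_of_lt K (by omega), rank_hankel1_eq_zero_of_lt K (by omega)]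

end Summit.Ventures.HSemireg.Wedge.HankelFrameChange
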